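import Literature.AlgebraicGeometry.DuqueFrancoVillaflor2025.ZeroDimensionalFakeLinearCycles
import Literature.AlgebraicGeometry.DuqueFrancoVillaflor2025.JoinMilnorNumber
import HarnessLib

/-!
# Fake linear cycles on the surfaces `{F₀(x₀,x₁) + F₁(x₂,x₃) = 0}` (Duque Franco–Villaflor 2025,
# Thm. 1.5 via Thm. 7.1 and Cor. 6.1) — algebraic core, the case `n = 2`

Certified instances and evidence bearing on the general Hodge conjecture; no claim.

J. Duque Franco, R. Villaflor Loyola, *Periods of join algebraic cycles*, Ann. Sc. Norm. Super. Pisa (2025)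
= arXiv:2312.17222 [DuqueFrancoVillaflor2025Join]. Proof of Thm. 1.5 (held text p. 19, "Proof of (thm3)"),
verbatim: "Pick any degree `d` homogeneous polynomials `F_0, …, F_{n/2} ∈ ℚ[x,y]_d` such that each `F_i` has
only simple rational roots. Define `X := {F_0(x_0,x_1) + F_1(x_2,x_3) + ⋯ + F_{n/2}(x_n,x_{n+1}) = 0} ⊆ ℙ^{n+1}`.
For each `i = 0, …, n/2` consider `X_i := {F_i(x_{2i},x_{2i+1}) = 0} ⊆ ℙ¹` and take any fake linear cycle
`δ_i ∈ H⁰(X_i,ℚ)_prim`. Then by (corHFjoin) `δ := J(δ_0, …, δ_{n/2}) ∈ H^{n/2,n/2}(X,ℚ)_prim` is a fake linear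
cycle." The ingredients in print: **Thm. 1.1** (`P_{J(Z₁,Z₂)} = P_{Z₁}·P_{Z₂}` and
`(J^{f+g} : P_{Z₁}P_{Z₂}) = J^{f,[Z₁]}S + J^{g,[Z₂]}S`; tree `IsArtinianGorenstein.colon_join`), **Cor. 6.1**
(`HF_{[J(Z₁,Z₂)]} = HF_{[Z₁]} * HF_{[Z₂]}`; tree `IsArtinianGorenstein.hilbert_colon_join`), **Thm. 7.1** (the
`0`-dimensional fake linear cycles, tree `ZeroDimensionalFakeLinearCycles`), Def. 7.1 (fake version of `[Z]`:
same Hilbert function, `λ_prim ∉ K·[Z]_prim`).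

NUMBERING (checked against the arXiv TeX sources, 2026-08-21): in arXiv v1–v3 (= the held text) the existence
theorem for fake linear cycles (LaTeX label `thm3`) is **Theorem 1.5** and the join theorem
`P_{J(Z₁,Z₂)} = P_{Z₁}P_{Z₂}` (label `thm2`) is Theorem 1.1; in arXiv v4 (12 Sep 2025, the refereed revision) they
are renumbered Theorem 1.1 and Theorem 1.2 respectively (and v≤3 Thm. 1.2 / 1.3 / 1.4 become Thm. 3.1 / 4.1 /
5.1); §6–§7 (Cor. 6.1, Ex. 6.1, Def. 7.1, Rem. 7.1, Thm. 7.1, Thm. 7.2) keep their numbers. This file cites the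
v1–v3 numbers, as the rest of the tree does. (An earlier revision of this docstring said "Thm. 1.3", which in
v1–v3 is the quadratic-fundamental-form theorem; corrected.)

## What this file PROVES (0 facts, 0 sorry), over any field `K` — the case `n = 2` (surfaces in `ℙ³`)

For two binary forms `F₀, F₁ ∈ K[x₀,x₁]` of degree `d` and the surface `X = {F₀(x₀,x₁) + F₁(x₂,x₃) = 0}`
(`sumForm F₀ F₁ ∈ K[x_{Fin 2 ⊔ Fin 2}]`, variables `inl 0, inl 1 = x₀, x₁` and `inr 0, inr 1 = x₂, x₃`):

* `sumJacobian_eq_join`: `J^{F₀ ⊕ F₁} = J^{F₀}·S + J^{F₁}·S` (tree `span_pderiv_sebastianiThom`, Thm. 1.1 proof);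
  `isArtinianGorenstein_sumJacobian`: it is Artinian Gorenstein of socle `4(d−2)` when both `J^{F_i}` are
  (socle `2(d−2)`), i.e. `X` is smooth when the `X_i` are.
* **`sumJacobian_colon_eq_lineIdeal`** (Thm. 1.1 + Thm. 7.1): for points `c₀, c₁ ∈ K` at which the partials of
  `F₀`, `F₁` do not both vanish and forms `P₀, P₁ ≠ 0` of degree `d − 2` with `P_i·(x − c_i y) ∈ J^{F_i}` (the
  classes `δ_i` with the Hilbert function of a point, genuine or fake):
  `(J^{F₀⊕F₁} : P₀(x₀,x₁)·P₁(x₂,x₃)) = ⟨x₀ − c₀x₁, x₁^{d−1}⟩·S + ⟨x₂ − c₁x₃, x₃^{d−1}⟩·S`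
  `= ⟨x₀ − c₀x₁, x₂ − c₁x₃, x₀^{d−1}, x₁^{d−1}, x₂^{d−1}, x₃^{d−1}⟩` (`lineIdeal d c₀ c₁`, `lineIdeal_eq_span`) — the
  shape of eq. (eqAGfakelcFermat) `J^{F,λ} = ⟨x₀ − c₀x₁, x₂ − c₁x₃, x_i^{d−1}⟩` for `n = 2`;
* **`hilbert_sumJacobian_colon`** (Cor. 6.1): its Hilbert function is `ciHilbert [d−1, d−1] = pointHF d * pointHF d`,
  the Hilbert function of a LINE class `J([p],[q]) = {x₀ = r x₁, x₂ = s x₃}`, the same for all `(c₀, c₁)`;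
* **`ne_smul_of_join`** (Def. 7.1, fakeness): for `d ≥ 3` the classes attached to `(c₀,c₁) ≠ (c₀',c₁')` are never
  proportional (`lineIdeal_injective`: project to one block and use `pointIdeal_injective`);
* **`splitSurface_fake_linear_cycle`** — Thm. 1.5 for `n = 2` assembled on the printed surfaces
  `X = {∏_i(x₀ − r_ix₁) + ∏_j(x₂ − s_jx₃) = 0}` (`r`, `s` injective, `d ≥ 3`, `d ≠ 0` in `K`): for `c₀ ∉ {r_i}` or
  `c₁ ∉ {s_j}`, the join `P₀(x₀,x₁)P₁(x₂,x₃)` of the point-type classes at `c₀`, `c₁` has (i) the Gorenstein ideal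
  `⟨x₀ − c₀x₁, x₂ − c₁x₃, x_i^{d−1}⟩`, (ii) the Hilbert function of every genuine line class `J([p_i],[q_j])`, and
  (iii) is not a scalar multiple of any of them — a fake linear cycle (fake version of `[J(p_i,q_j)]`).

Not formalised (cited): `P_{J(Z₁,Z₂)} = P_{Z₁}P_{Z₂}` as a statement about residues/periods (Thm. 1.1, first part)
and the dictionary `(J^F : P_λ) = J^{F,λ}`; general even `n` (iterate the join) is not spelled out here.

## References

* [DuqueFrancoVillaflor2025Join] Thm. 1.1, Cor. 6.1, Def. 7.1, Thm. 7.1, proof of Thm. 1.5 (p. 19; = Thm. 1.1 of arXiv v4), Rem. 7.1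
  eq. (eqAGfakelcFermat).
-/

noncomputable section

open MvPolynomial Module
open Literature.RingTheory.MvPolynomial Literature.AlgebraicGeometry.Kloosterman2023
open Literature.AlgebraicGeometry.HodgeTheory
open Literature.AlgebraicGeometry.Motives.UniversalHypersurface

attribute [local instance] MvPolynomial.gradedAlgebra

namespace Literature.AlgebraicGeometry.DuqueFrancoVillaflor2025

universe u

variable {K : Type u} [Field K] {d : ℕ}

/-! ## The surface `X = {F₀(x₀,x₁) + F₁(x₂,x₃) = 0}` and its Jacobian ideal -/

/-- **The form `F₀(x₀,x₁) + F₁(x₂,x₃)`** in the variables `Fin 2 ⊔ Fin 2` (`inl` = the block `x₀,x₁`, `inr` = the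
block `x₂,x₃`): DFV's `X := {F_0(x_0,x_1) + F_1(x_2,x_3) = 0}` for `n = 2`.
[cite: DuqueFrancoVillaflor2025Join, Theorem 1.5 (proof; = Theorem 1.1 of arXiv v4)] -/
def sumForm (F₀ F₁ : MvPolynomial (Fin 2) K) : MvPolynomial (Fin 2 ⊕ Fin 2) K :=
  rename Sum.inl F₀ + rename Sum.inr F₁

/-- The Jacobian ideal `J^{F₀ ⊕ F₁} = ⟨∂/∂z (F₀(x) + F₁(y)) : z⟩`. [cite: DuqueFrancoVillaflor2025Join, Theorem 1.1 (proof)] -/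
def sumJacobian (F₀ F₁ : MvPolynomial (Fin 2) K) : Ideal (MvPolynomial (Fin 2 ⊕ Fin 2) K) :=
  Ideal.span (Set.range fun z : Fin 2 ⊕ Fin 2 => pderiv z (sumForm F₀ F₁))

/-- **`J^{F₀ ⊕ F₁} = J^{F₀}·S + J^{F₁}·S`** (disjoint variables; tree `span_pderiv_sebastianiThom`).
[cite: DuqueFrancoVillaflor2025Join, Theorem 1.1 (proof)] -/
theorem sumJacobian_eq_join (F₀ F₁ : MvPolynomial (Fin 2) K) :
    sumJacobian F₀ F₁ = (jacobianIdeal F₀).map (rename Sum.inl) ⊔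
      (jacobianIdeal F₁).map (rename Sum.inr : MvPolynomial (Fin 2) K →ₐ[K] MvPolynomial (Fin 2 ⊕ Fin 2) K) :=
  span_pderiv_sebastianiThom F₀ F₁

/-- **`X` is smooth when the `X_i` are**: if `J^{F₀}`, `J^{F₁}` are Artinian Gorenstein of socle `2(d−2)` then
`J^{F₀ ⊕ F₁}` is Artinian Gorenstein of socle `4(d−2)` (`= (n+2)(d−2)`, `n = 2`).
[cite: DuqueFrancoVillaflor2025Join, Theorem 1.1 (proof: "R^{f+g} = R^f ⊗ R^g")] -/
theorem isArtinianGorenstein_sumJacobian {F₀ F₁ : MvPolynomial (Fin 2) K}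
    (hJ₀ : IsArtinianGorenstein (jacobianIdeal F₀) (2 * (d - 2)))
    (hJ₁ : IsArtinianGorenstein (jacobianIdeal F₁) (2 * (d - 2))) :
    IsArtinianGorenstein (sumJacobian F₀ F₁) (2 * (d - 2) + 2 * (d - 2)) := by
  rw [sumJacobian_eq_join]
  exact isArtinianGorenstein_join hJ₀ hJ₁

/-! ## The Gorenstein ideal of a line class `{x₀ = c₀x₁, x₂ = c₁x₃}` -/

/-- **`⟨x₀ − c₀x₁, x₁^{d−1}⟩·S + ⟨x₂ − c₁x₃, x₃^{d−1}⟩·S`**, the join of two point ideals: the Gorenstein ideal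
of the line class `J([p],[q])` / of its fake versions (eq. (eqAGfakelcFermat) for `n = 2`).
[cite: DuqueFrancoVillaflor2025Join, Remark 7.1, eq. (eqAGfakelcFermat)] -/
def lineIdeal (d : ℕ) (c₀ c₁ : K) : Ideal (MvPolynomial (Fin 2 ⊕ Fin 2) K) :=
  (pointIdeal d c₀).map (rename Sum.inl : MvPolynomial (Fin 2) K →ₐ[K] MvPolynomial (Fin 2 ⊕ Fin 2) K) ⊔
    (pointIdeal d c₁).map (rename Sum.inr : MvPolynomial (Fin 2) K →ₐ[K] MvPolynomial (Fin 2 ⊕ Fin 2) K)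

/-- The explicit generators: `⟨x₀ − c₀x₁, x₀^{d−1}, x₁^{d−1}, x₂ − c₁x₃, x₂^{d−1}, x₃^{d−1}⟩`.
[cite: DuqueFrancoVillaflor2025Join, Remark 7.1, eq. (eqAGfakelcFermat)] -/
theorem lineIdeal_eq_span (d : ℕ) (c₀ c₁ : K) :
    lineIdeal d c₀ c₁ = Ideal.span
      {X (Sum.inl 0) - C c₀ * X (Sum.inl 1), X (Sum.inl 0) ^ (d - 1), X (Sum.inl 1) ^ (d - 1),
        X (Sum.inr 0) - C c₁ * X (Sum.inr 1), X (Sum.inr 0) ^ (d - 1),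
        (X (Sum.inr 1) : MvPolynomial (Fin 2 ⊕ Fin 2) K) ^ (d - 1)} := by
  rw [lineIdeal, pointIdeal_eq_span_three, pointIdeal_eq_span_three, Ideal.map_span, Ideal.map_span,
    ← Ideal.span_union]
  congr 1
  ext g
  simp only [Set.image_insert_eq, Set.image_singleton, map_sub, map_mul, map_pow, rename_X, rename_C,
    Set.union_insert, Set.union_singleton, Set.mem_insert_iff, Set.mem_singleton_iff, pointForm]
  tauto

/-- The line ideal is Artinian Gorenstein of socle `(d−2) + (d−2)` (`d ≥ 2`).
[cite: DuqueFrancoVillaflor2025Join, Definition 2.1 and Remark 7.1] -/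
theorem isArtinianGorenstein_lineIdeal (hd : 2 ≤ d) (c₀ c₁ : K) :
    IsArtinianGorenstein (lineIdeal d c₀ c₁) ((d - 2) + (d - 2)) :=
  isArtinianGorenstein_join (isArtinianGorenstein_pointIdeal hd c₀) (isArtinianGorenstein_pointIdeal hd c₁)

/-- **The Hilbert function of the line ideal is `pointHF d * pointHF d = ciHilbert [d−1, d−1]`** (Cor. 6.1:
`HF_{[J(Z₁,Z₂)]} = HF_{[Z₁]} * HF_{[Z₂]}`), independently of `(c₀, c₁)`.
[cite: DuqueFrancoVillaflor2025Join, Corollary 6.1 and Example 6.1] -/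
theorem hilbert_lineIdeal (hd : 2 ≤ d) (c₀ c₁ : K) (k : ℕ) :
    finrank K (homogeneousSubmodule (Fin 2 ⊕ Fin 2) K k) - finrank K (idealDegree (lineIdeal d c₀ c₁) k) =
      ciHilbert [d - 1, d - 1] k := by
  rw [lineIdeal, (isArtinianGorenstein_pointIdeal hd c₀).hilbert_join (isArtinianGorenstein_pointIdeal hd c₁) k,
    ciHilbert_cons_eq_conv, ← pointHF_eq_ciHilbert]
  congr 1 <;> funext p <;> exact hilbert_pointIdeal hd _ p

/-! ## The colon ideal of a join of two point-type classes -/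

section Colon

variable {F₀ F₁ : MvPolynomial (Fin 2) K}

/-- **Thm. 1.1 + Thm. 7.1 (`n = 2`): the Gorenstein ideal of `P₀(x₀,x₁)·P₁(x₂,x₃)`.** For binary forms `F₀, F₁`
of degree `d ≥ 2` with Artinian Gorenstein Jacobian ideals, points `c₀, c₁` at which the partials of `F₀` resp.
`F₁` do not both vanish, and forms `P₀, P₁ ≠ 0` of degree `d − 2` with `P_i·(x − c_i y) ∈ J^{F_i}`:
`(J^{F₀⊕F₁} : P₀(x₀,x₁)P₁(x₂,x₃)) = ⟨x₀ − c₀x₁, x₁^{d−1}⟩S + ⟨x₂ − c₁x₃, x₃^{d−1}⟩S`.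
[cite: DuqueFrancoVillaflor2025Join, Theorem 1.1 and Theorem 7.1] -/
theorem sumJacobian_colon_eq_lineIdeal (hd : 2 ≤ d) (hF₀ : F₀.IsHomogeneous d) (hF₁ : F₁.IsHomogeneous d)
    (hJ₀ : IsArtinianGorenstein (jacobianIdeal F₀) (2 * (d - 2)))
    (hJ₁ : IsArtinianGorenstein (jacobianIdeal F₁) (2 * (d - 2))) {c₀ c₁ : K}
    (hc₀ : eval ![c₀, 1] (pderiv 0 F₀) ≠ 0 ∨ eval ![c₀, 1] (pderiv 1 F₀) ≠ 0)
    (hc₁ : eval ![c₁, 1] (pderiv 0 F₁) ≠ 0 ∨ eval ![c₁, 1] (pderiv 1 F₁) ≠ 0)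
    {P₀ P₁ : MvPolynomial (Fin 2) K} (hP₀h : P₀.IsHomogeneous (d - 2)) (hP₀0 : P₀ ≠ 0)
    (hP₀ : P₀ * pointForm c₀ ∈ jacobianIdeal F₀) (hP₁h : P₁.IsHomogeneous (d - 2)) (hP₁0 : P₁ ≠ 0)
    (hP₁ : P₁ * pointForm c₁ ∈ jacobianIdeal F₁) :
    (sumJacobian F₀ F₁).colon {rename Sum.inl P₀ * rename Sum.inr P₁} = lineIdeal d c₀ c₁ := by
  rw [sumJacobian_eq_join, hJ₀.colon_join hJ₁, jacobianIdeal_colon_eq_pointIdeal hd hF₀ hJ₀ hc₀ hP₀h hP₀0 hP₀,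
    jacobianIdeal_colon_eq_pointIdeal hd hF₁ hJ₁ hc₁ hP₁h hP₁0 hP₁, lineIdeal]

/-- **Cor. 6.1 (`n = 2`): the Hilbert function of `(J^{F₀⊕F₁} : P₀P₁)` is `ciHilbert [d−1, d−1]`**, that of a line
class — the same for all `(c₀, c₁)` ("`HF_δ = HF_{[J(p,q)]}`"). [cite: DuqueFrancoVillaflor2025Join, Corollary 6.1 and Theorem 1.5 (proof; = Theorem 1.1 of arXiv v4)] -/
theorem hilbert_sumJacobian_colon (hd : 2 ≤ d) (hF₀ : F₀.IsHomogeneous d) (hF₁ : F₁.IsHomogeneous d)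
    (hJ₀ : IsArtinianGorenstein (jacobianIdeal F₀) (2 * (d - 2)))
    (hJ₁ : IsArtinianGorenstein (jacobianIdeal F₁) (2 * (d - 2))) {c₀ c₁ : K}
    (hc₀ : eval ![c₀, 1] (pderiv 0 F₀) ≠ 0 ∨ eval ![c₀, 1] (pderiv 1 F₀) ≠ 0)
    (hc₁ : eval ![c₁, 1] (pderiv 0 F₁) ≠ 0 ∨ eval ![c₁, 1] (pderiv 1 F₁) ≠ 0)
    {P₀ P₁ : MvPolynomial (Fin 2) K} (hP₀h : P₀.IsHomogeneous (d - 2)) (hP₀0 : P₀ ≠ 0)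
    (hP₀ : P₀ * pointForm c₀ ∈ jacobianIdeal F₀) (hP₁h : P₁.IsHomogeneous (d - 2)) (hP₁0 : P₁ ≠ 0)
    (hP₁ : P₁ * pointForm c₁ ∈ jacobianIdeal F₁) (k : ℕ) :
    finrank K (homogeneousSubmodule (Fin 2 ⊕ Fin 2) K k) -
        finrank K (idealDegree ((sumJacobian F₀ F₁).colon {rename Sum.inl P₀ * rename Sum.inr P₁}) k) =
      ciHilbert [d - 1, d - 1] k := by
  rw [sumJacobian_colon_eq_lineIdeal hd hF₀ hF₁ hJ₀ hJ₁ hc₀ hc₁ hP₀h hP₀0 hP₀ hP₁h hP₁0 hP₁, hilbert_lineIdeal hd]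

end Colon

/-! ## Fakeness: different points, different line ideals -/

/-- Projection onto the first block: `x_{inl i} ↦ x_i`, `x_{inr j} ↦ 0`. [folklore] -/
private def projL : MvPolynomial (Fin 2 ⊕ Fin 2) K →ₐ[K] MvPolynomial (Fin 2) K := aeval (Sum.elim X 0)

/-- Projection onto the second block: `x_{inl i} ↦ 0`, `x_{inr j} ↦ x_j`. [folklore] -/
private def projR : MvPolynomial (Fin 2 ⊕ Fin 2) K →ₐ[K] MvPolynomial (Fin 2) K := aeval (Sum.elim 0 X)

/-- A point ideal (`d ≥ 2`) dies under `x ↦ 0`: its generators have positive degree. [folklore] -/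
private theorem map_aeval_zero_pointIdeal (hd : 2 ≤ d) (c : K) {f : Fin 2 ⊕ Fin 2 → MvPolynomial (Fin 2) K}
    (ι : Fin 2 → Fin 2 ⊕ Fin 2) (hf : ∀ i, f (ι i) = 0) :
    (pointIdeal d c).map ((aeval f).comp (rename ι) : MvPolynomial (Fin 2) K →ₐ[K] MvPolynomial (Fin 2) K) = ⊥ := by
  rw [pointIdeal, Ideal.map_span, Ideal.span_eq_bot]
  rintro _ ⟨_, ⟨i, rfl⟩, rfl⟩
  match i with
  | 0 => simp [pointIdealGens, pointForm, hf]
  | 1 =>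
    have : d - 1 ≠ 0 := by omega
    simp [pointIdealGens, hf, this]

/-- Projection of the line ideal to the first block is the point ideal of `c₀`. [folklore] -/
private theorem map_projL_lineIdeal (hd : 2 ≤ d) (c₀ c₁ : K) :
    (lineIdeal d c₀ c₁).map (projL (K := K)) = pointIdeal d c₀ := by
  rw [lineIdeal, Ideal.map_sup, Ideal.map_mapₐ, Ideal.map_mapₐ]
  have h1 : (projL (K := K)).comp (rename Sum.inl) = AlgHom.id K _ := by
    refine MvPolynomial.algHom_ext fun i => ?_
    simp [projL]
  have h2 : (pointIdeal d c₁).map ((projL (K := K)).comp (rename Sum.inr)) = ⊥ :=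
    map_aeval_zero_pointIdeal hd c₁ Sum.inr (fun _ => rfl)
  rw [h1, h2, Ideal.map_idₐ, sup_bot_eq]

/-- Projection of the line ideal to the second block is the point ideal of `c₁`. [folklore] -/
private theorem map_projR_lineIdeal (hd : 2 ≤ d) (c₀ c₁ : K) :
    (lineIdeal d c₀ c₁).map (projR (K := K)) = pointIdeal d c₁ := by
  rw [lineIdeal, Ideal.map_sup, Ideal.map_mapₐ, Ideal.map_mapₐ]
  have h1 : (projR (K := K)).comp (rename Sum.inr) = AlgHom.id K _ := by
    refine MvPolynomial.algHom_ext fun i => ?_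
    simp [projR]
  have h2 : (pointIdeal d c₀).map ((projR (K := K)).comp (rename Sum.inl)) = ⊥ :=
    map_aeval_zero_pointIdeal hd c₀ Sum.inl (fun _ => rfl)
  rw [h1, h2, Ideal.map_idₐ, bot_sup_eq]

/-- **`(c₀, c₁) ↦ lineIdeal d c₀ c₁` is injective for `d ≥ 3`**: the Gorenstein ideals of (fake or genuine) line
classes attached to different pairs of points differ (Rem. 2.1: equal `J^{F,λ}` iff proportional classes).
[cite: DuqueFrancoVillaflor2025Join, Remark 2.1 and Definition 7.1] -/
theorem lineIdeal_injective (hd : 3 ≤ d) {c₀ c₁ c₀' c₁' : K} (h : lineIdeal d c₀ c₁ = lineIdeal d c₀' c₁') :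
    c₀ = c₀' ∧ c₁ = c₁' := by
  have hd2 : 2 ≤ d := by omega
  constructor
  · apply pointIdeal_injective hd
    rw [← map_projL_lineIdeal hd2 c₀ c₁, ← map_projL_lineIdeal hd2 c₀' c₁', h]
  · apply pointIdeal_injective hd
    rw [← map_projR_lineIdeal hd2 c₀ c₁, ← map_projR_lineIdeal hd2 c₀' c₁', h]

/-- `(I : a·P) = (I : P)` for a non-zero scalar `a`. [folklore] -/
private theorem colon_singleton_smul' {σ : Type*} (I : Ideal (MvPolynomial σ K)) {a : K} (ha : a ≠ 0)
    (P : MvPolynomial σ K) : I.colon {a • P} = I.colon {P} := by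
  ext g
  rw [Submodule.mem_colon_singleton, Submodule.mem_colon_singleton, smul_eq_mul, smul_eq_mul,
    smul_eq_C_mul, mul_left_comm]
  exact Ideal.unit_mul_mem_iff_mem I ((isUnit_iff_ne_zero.mpr ha).map C)

section Fake

variable {F₀ F₁ : MvPolynomial (Fin 2) K}

/-- **Fakeness for joins (Def. 7.1 at the level of polynomials, `n = 2`).** For `d ≥ 3`, the joins
`P₀(x₀,x₁)P₁(x₂,x₃)` and `P₀'(x₀,x₁)P₁'(x₂,x₃)` of point-type classes attached to `(c₀,c₁) ≠ (c₀',c₁')` are never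
proportional: their Gorenstein ideals are different line ideals.
[cite: DuqueFrancoVillaflor2025Join, Definition 7.1 and Theorem 1.5 (proof; = Theorem 1.1 of arXiv v4)] -/
theorem ne_smul_of_join (hd : 3 ≤ d) (hF₀ : F₀.IsHomogeneous d) (hF₁ : F₁.IsHomogeneous d)
    (hJ₀ : IsArtinianGorenstein (jacobianIdeal F₀) (2 * (d - 2)))
    (hJ₁ : IsArtinianGorenstein (jacobianIdeal F₁) (2 * (d - 2))) {c₀ c₁ c₀' c₁' : K}
    (hne : (c₀, c₁) ≠ (c₀', c₁'))
    (hc₀ : eval ![c₀, 1] (pderiv 0 F₀) ≠ 0 ∨ eval ![c₀, 1] (pderiv 1 F₀) ≠ 0)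
    (hc₁ : eval ![c₁, 1] (pderiv 0 F₁) ≠ 0 ∨ eval ![c₁, 1] (pderiv 1 F₁) ≠ 0)
    (hc₀' : eval ![c₀', 1] (pderiv 0 F₀) ≠ 0 ∨ eval ![c₀', 1] (pderiv 1 F₀) ≠ 0)
    (hc₁' : eval ![c₁', 1] (pderiv 0 F₁) ≠ 0 ∨ eval ![c₁', 1] (pderiv 1 F₁) ≠ 0)
    {P₀ P₁ P₀' P₁' : MvPolynomial (Fin 2) K}
    (hP₀h : P₀.IsHomogeneous (d - 2)) (hP₀0 : P₀ ≠ 0) (hP₀ : P₀ * pointForm c₀ ∈ jacobianIdeal F₀)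
    (hP₁h : P₁.IsHomogeneous (d - 2)) (hP₁0 : P₁ ≠ 0) (hP₁ : P₁ * pointForm c₁ ∈ jacobianIdeal F₁)
    (hP₀'h : P₀'.IsHomogeneous (d - 2)) (hP₀'0 : P₀' ≠ 0) (hP₀' : P₀' * pointForm c₀' ∈ jacobianIdeal F₀)
    (hP₁'h : P₁'.IsHomogeneous (d - 2)) (hP₁'0 : P₁' ≠ 0) (hP₁' : P₁' * pointForm c₁' ∈ jacobianIdeal F₁)
    (μ : K) : rename Sum.inl P₀ * rename Sum.inr P₁ ≠ μ • (rename Sum.inl P₀' * rename Sum.inr P₁') := by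
  have hd2 : 2 ≤ d := by omega
  intro h
  have hμ : μ ≠ 0 := by
    rintro rfl
    rw [zero_smul, mul_eq_zero] at h
    rcases h with h0 | h0
    · exact hP₀0 ((rename_injective _ Sum.inl_injective).eq_iff' (map_zero _) |>.mp h0)
    · exact hP₁0 ((rename_injective _ Sum.inr_injective).eq_iff' (map_zero _) |>.mp h0)
  have h1 := sumJacobian_colon_eq_lineIdeal hd2 hF₀ hF₁ hJ₀ hJ₁ hc₀ hc₁ hP₀h hP₀0 hP₀ hP₁h hP₁0 hP₁
  have h2 := sumJacobian_colon_eq_lineIdeal hd2 hF₀ hF₁ hJ₀ hJ₁ hc₀' hc₁' hP₀'h hP₀'0 hP₀' hP₁'h hP₁'0 hP₁'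
  rw [h, colon_singleton_smul' _ hμ, h2] at h1
  obtain ⟨h0, h1'⟩ := lineIdeal_injective hd h1.symm
  exact hne (Prod.ext h0 h1')

end Fake

/-! ## Theorem 1.5 (`n = 2`) on the printed surfaces `{∏(x₀ − r_ix₁) + ∏(x₂ − s_jx₃) = 0}` -/

section Split

/-- **`X = {∏_i(x₀ − r_ix₁) + ∏_j(x₂ − s_jx₃) = 0} ⊂ ℙ³` is smooth** for distinct `r_i`, distinct `s_j` and `d ≠ 0` in
`K`: its Jacobian ideal is Artinian Gorenstein of socle `4(d−2)`. [cite: DuqueFrancoVillaflor2025Join, Theorem 1.5 (proof; = Theorem 1.1 of arXiv v4)] -/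
theorem isArtinianGorenstein_sumJacobian_splitForm {r s : Fin d → K} (hr : Function.Injective r)
    (hs : Function.Injective s) (hd : 2 ≤ d) (hdK : (d : K) ≠ 0) :
    IsArtinianGorenstein (sumJacobian (splitForm r) (splitForm s)) (2 * (d - 2) + 2 * (d - 2)) :=
  isArtinianGorenstein_sumJacobian (isArtinianGorenstein_jacobianIdeal_splitForm hr hd hdK)
    (isArtinianGorenstein_jacobianIdeal_splitForm hs hd hdK)

/-- **Duque Franco–Villaflor, Thm. 1.5 (= Thm. 1.1 of arXiv v4) for `n = 2` (algebraic core): the surfaces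
`X = {∏_i(x₀ − r_ix₁) + ∏_j(x₂ − s_jx₃) = 0}` carry fake linear cycles, in every degree `d ≥ 3`.** Let `r, s` be
injective, `d ≥ 3`, `d ≠ 0` in `K`; let `c₀, c₁ ∈ K` with `(c₀, c₁)` not a pair of roots `(r_i, s_j)`, and let
`P₀, P₁ ≠ 0` be forms of degree `d − 2` with `P₀·(x₀ − c₀x₁) ∈ J^{F₀}`, `P₁·(x₂ − c₁x₃) ∈ J^{F₁}` (DFV's `P` of
Thm. 7.1 at a non-root, the point polynomial `P_i` at a root — both exist and are non-zero:
`exists_dfvPolynomial_splitForm`, `exists_pointPolynomial_splitForm`). Then for the join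
`P = P₀(x₀,x₁)·P₁(x₂,x₃)` (`= P_{J(δ₀,δ₁)}` by Thm. 1.1) and EVERY genuine line class `J([p_i],[q_j])`
(polynomial `Q₀(x₀,x₁)Q₁(x₂,x₃)`, `Q₀·(x₀ − r_ix₁) ∈ J^{F₀}`, `Q₁·(x₂ − s_jx₃) ∈ J^{F₁}`, `Q₀, Q₁ ≠ 0`):
(i) `(J^F : P) = ⟨x₀ − c₀x₁, x₀^{d−1}, x₁^{d−1}, x₂ − c₁x₃, x₂^{d−1}, x₃^{d−1}⟩`; (ii) `(J^F : P)` and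
`(J^F : Q₀Q₁)` have the same Hilbert function (`ciHilbert [d−1,d−1]`, that of a line); (iii) `P` is not a scalar
multiple of `Q₀Q₁`. So `δ = J(δ₀,δ₁)` is a fake version of every line class `[J(p_i,q_j)]`.
[cite: DuqueFrancoVillaflor2025Join, Theorem 1.5 (proof; = Theorem 1.1 of arXiv v4) and Definition 7.1] -/
theorem splitSurface_fake_linear_cycle {r s : Fin d → K} (hr : Function.Injective r) (hs : Function.Injective s)
    (hd : 3 ≤ d) (hdK : (d : K) ≠ 0) {c₀ c₁ : K} (hc : ∀ i j, (c₀, c₁) ≠ (r i, s j))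
    {P₀ P₁ : MvPolynomial (Fin 2) K} (hP₀h : P₀.IsHomogeneous (d - 2)) (hP₀0 : P₀ ≠ 0)
    (hP₀ : P₀ * pointForm c₀ ∈ jacobianIdeal (splitForm r)) (hP₁h : P₁.IsHomogeneous (d - 2)) (hP₁0 : P₁ ≠ 0)
    (hP₁ : P₁ * pointForm c₁ ∈ jacobianIdeal (splitForm s)) (i j : Fin d)
    {Q₀ Q₁ : MvPolynomial (Fin 2) K} (hQ₀h : Q₀.IsHomogeneous (d - 2)) (hQ₀0 : Q₀ ≠ 0)
    (hQ₀ : Q₀ * pointForm (r i) ∈ jacobianIdeal (splitForm r)) (hQ₁h : Q₁.IsHomogeneous (d - 2)) (hQ₁0 : Q₁ ≠ 0)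
    (hQ₁ : Q₁ * pointForm (s j) ∈ jacobianIdeal (splitForm s)) :
    (sumJacobian (splitForm r) (splitForm s)).colon {rename Sum.inl P₀ * rename Sum.inr P₁} =
        Ideal.span {X (Sum.inl 0) - C c₀ * X (Sum.inl 1), X (Sum.inl 0) ^ (d - 1), X (Sum.inl 1) ^ (d - 1),
          X (Sum.inr 0) - C c₁ * X (Sum.inr 1), X (Sum.inr 0) ^ (d - 1),
          (X (Sum.inr 1) : MvPolynomial (Fin 2 ⊕ Fin 2) K) ^ (d - 1)} ∧
      (∀ k, finrank K (homogeneousSubmodule (Fin 2 ⊕ Fin 2) K k) -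
          finrank K (idealDegree ((sumJacobian (splitForm r) (splitForm s)).colon
            {rename Sum.inl P₀ * rename Sum.inr P₁}) k) =
        finrank K (homogeneousSubmodule (Fin 2 ⊕ Fin 2) K k) -
          finrank K (idealDegree ((sumJacobian (splitForm r) (splitForm s)).colon
            {rename Sum.inl Q₀ * rename Sum.inr Q₁}) k)) ∧
      ∀ μ : K, rename Sum.inl P₀ * rename Sum.inr P₁ ≠ μ • (rename Sum.inl Q₀ * rename Sum.inr Q₁) := by
  have hd2 : 2 ≤ d := by omega
  have hF₀ := isHomogeneous_splitForm r
  have hF₁ := isHomogeneous_splitForm s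
  have hJ₀ := isArtinianGorenstein_jacobianIdeal_splitForm hr hd2 hdK
  have hJ₁ := isArtinianGorenstein_jacobianIdeal_splitForm hs hd2 hdK
  have hc₀ := eval_pderiv_splitForm_ne_zero hr hdK c₀
  have hc₁ := eval_pderiv_splitForm_ne_zero hs hdK c₁
  have hr₀ := eval_pderiv_splitForm_ne_zero hr hdK (r i)
  have hs₁ := eval_pderiv_splitForm_ne_zero hs hdK (s j)
  refine ⟨?_, fun k => ?_, fun μ => ?_⟩
  · rw [sumJacobian_colon_eq_lineIdeal hd2 hF₀ hF₁ hJ₀ hJ₁ hc₀ hc₁ hP₀h hP₀0 hP₀ hP₁h hP₁0 hP₁, lineIdeal_eq_span]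
  · rw [hilbert_sumJacobian_colon hd2 hF₀ hF₁ hJ₀ hJ₁ hc₀ hc₁ hP₀h hP₀0 hP₀ hP₁h hP₁0 hP₁ k,
      hilbert_sumJacobian_colon hd2 hF₀ hF₁ hJ₀ hJ₁ hr₀ hs₁ hQ₀h hQ₀0 hQ₀ hQ₁h hQ₁0 hQ₁ k]
  · exact ne_smul_of_join hd hF₀ hF₁ hJ₀ hJ₁ (hc i j) hc₀ hc₁ hr₀ hs₁ hP₀h hP₀0 hP₀ hP₁h hP₁0 hP₁ hQ₀h hQ₀0 hQ₀
      hQ₁h hQ₁0 hQ₁ μ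

end Split

end Literature.AlgebraicGeometry.DuqueFrancoVillaflor2025

end
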